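import Mathlib.Algebra.Algebra.Subalgebra.Directed
import Mathlib.Algebra.MvPolynomial.Monad
import Mathlib.FieldTheory.IntermediateField.Adjoin.Algebra
import Mathlib.RingTheory.Localization.FractionRing
import Mathlib.RingTheory.AlgebraicIndependent.Defs
import Mathlib.RingTheory.Ideal.Quotient.Operations
import Mathlib.FieldTheory.IsAlgClosed.Basic
import Literature.NumberTheory.Transcendental.GammaFields
import Literature.NumberTheory.Transcendental.ZilberField
import HarnessLib

/-!
# ℵ₀-saturation of exponentially-algebraically closed fields for Γ-algebraic extensions
(Bays–Kirby 2018, Props 11.2 and 11.5)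

M. Bays, J. Kirby, *Pseudo-exponential maps, variants, and quasiminimality*, Algebra & Number
Theory 12 (2018) 493–549 (arXiv:1512.04262), §11.1, prove for a full Γ-field `F` and a
countable full Γ-subfield `K` which is Γ-closed in `F`, `K ◁_cl F`, `K ≠ F` (the base of §5.2 /
Def. 5.18 is a countable full Γ-field; a `K ◁_cl F` is automatically full):

* **Prop. 11.5.** `F` is generically strongly Γ-closed over `K` (GSΓC) iff it is generically
  Γ-closed over `K` (GΓC) — via the horizontal semiabelian weak Zilber–Pink theorem 11.4
  (Kirby 2009, "TEDESV");
* **Prop. 11.2.** `F` is GSΓC over `K` iff `F` is *`ℵ₀`-saturated for Γ-algebraic extensions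
  which are purely Γ-transcendental over `K`* (Def. 5.14: whenever `K ◁ A ◁ F` with `A`
  finitely generated over `K` and `A ◁ B` is a finitely generated Γ-algebraic extension, `B`
  embeds — necessarily strongly — into `F` over `A`; saturation in the arrow form of Def. 5.2);

and use, in the proof of Cor. 11.7 (`ℂ_exp` EAC ⟹ quasiminimal, Thm 1.5), that Γ-closedness
(Def. 10.3 = exponential-algebraic closedness, `Literature.NumberTheory.Transcendental.IsExpAlgClosed`, by the Rabinowitsch remark
after Def. 10.3) "clearly implies generic Γ-closedness" over any such `K`.

This file vendors the conjunction of these results, in the exponential case inside `F`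
(vocabulary of `GammaFields.lean`: `ℚ`-subspaces `Λ ≤ F`, predimension `GammaField.predim`,
strong subspaces `GammaField.IsStrong`, Γ-closed subspaces `GammaField.IsGammaClosed`), as the
named fact `Literature.NumberTheory.Transcendental.BaysKirby2018_saturation_of_isExpAlgClosed`, together with the (elementary,
proved) vocabulary needed to state "embeds into `F` over `A`":

* `GammaField.lvGens M c` — for a tuple `c : Fin N → F`, the level-`M` generators
  `(c, exp (c / M!))` of the Γ-field `⟨K c⟩` generated by `c` over `K`: as a field,
  `⟨K c⟩ = K₀(cᵢ, exp (cᵢ/m) : i < N, m ≥ 1) = ⋃_M K₀(c, exp (c/M!))` where `K₀ = ℚ(K, exp K)`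
  (`GammaField.fieldOf K`), since `Γ(⟨K c⟩)` is the graph of `exp` on `K + ℚc`;
* `GammaField.lvAlgebra K M c = K₀[c, exp (c/M!)]`, the `K₀`-subalgebra of `F` they generate;
* `GammaField.IsGammaIso K c c'` — "`c ↦ c'` defines an isomorphism of Γ-fields
  `⟨K c⟩ ≅ ⟨K c'⟩` over `K`", rendered as: for every `M` there is a `K₀`-algebra isomorphism
  `K₀[c, exp (c/M!)] ≃ K₀[c', exp (c'/M!)]` matching generators. (Such isomorphisms of domains
  extend uniquely to the fraction fields, are automatically compatible as `M` grows since they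
  are determined by the generators, and their union is a field isomorphism `θ : ⟨K c⟩ ≅ ⟨K c'⟩`
  over `K₀` with `θ(K + ℚc) = K + ℚc'` and `θ ∘ exp = exp ∘ θ` on `K + ℚc`, i.e. an
  isomorphism of Γ-fields over `K`; conversely such a `θ` restricts to the levels.) We prove
  the equivalent "same ideal of algebraic relations over `K₀`" form
  (`GammaField.isGammaIso_iff_ker_eq`), that `IsGammaIso K` is an equivalence relation, and —
  section *Faithfulness* — that the parenthetical claim holds:
  **`GammaField.isGammaIso_iff_exists_ringEquiv`**: `IsGammaIso K c c'` iff there is a field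
  isomorphism `θ : K₀(allGens c) ≃+* K₀(allGens c')` which is the identity on `K₀`, sends
  `cᵢ ↦ c'ᵢ`, maps `K + ℚc` into `K + ℚc'` and satisfies `θ (exp x) = exp (θ x)` there, where
  `K₀(allGens c)`, the field generated over `K₀` by all division points `cᵢ, exp (cᵢ/M!)`
  (`GammaField.allGens`), *is* the Γ-subfield `GammaField.fieldOf (K + ℚc)` of
  `GammaFields.lean` (`GammaField.restrictScalars_adjoinField_allGens`). The isomorphism is
  built by gluing the level isomorphisms along the chain of level algebras
  (`Subalgebra.iSupLift`; compatibility because related tuples satisfy the same relations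
  across levels, `IsGammaIso.aeval_eq_aeval`) and passing to fraction fields
  (`IsFractionRing.ringEquivOfRingEquiv`); the converse evaluates polynomials through `θ`.

Nothing here is specific to `ℂ`; the fact is used (with `K = ecl ∅`) in the proof of
Bays–Kirby Cor. 11.7 / Thm 1.5 (`ZilberQuasiminimalProofs.lean`).

## References

* M. Bays, J. Kirby, *Pseudo-exponential maps, variants, and quasiminimality*, Algebra & Number
  Theory 12 (2018) 493–549: Def. 3.8, Def. 5.2, Def. 5.11, Def. 5.14, Def. 5.16, Remark 5.17,
  Def. 10.3 (and the remark following it), Def. 11.1, Prop. 11.2, Thm 11.4, Prop. 11.5,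
  Cor. 11.7 (proof).
* J. Kirby, *The theory of the exponential differential equations of semiabelian varieties*,
  Selecta Math. 15 (2009) 445–486 (weak Zilber–Pink, Fact 11.3 of Bays–Kirby).
-/

noncomputable section

open Set

namespace Literature.NumberTheory.Transcendental

namespace GammaField

open Literature.ModelTheory.ExponentialFields.ExponentialRing

variable {F : Type*} [Field F] [CharZero F] [Literature.ModelTheory.ExponentialFields.ExponentialRing F]

/-! ### Level-`M` generators of the Γ-field generated by a tuple -/

/-- The **level-`M` generators** of the Γ-field generated over `K` by a tuple `c : Fin N → F`:
the coordinates `cᵢ` and the division points `exp (cᵢ / M!)` of `exp cᵢ` (Bays–Kirby 2018,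
Def. 3.8: a Γ-field is generated as a field by the coordinates of `Γ`; here
`Γ(⟨K c⟩) = {(x, eˣ) : x ∈ K + ℚc}` and `exp (q • cᵢ)`, `q = a/M!`, is a power of
`exp (cᵢ / M!)`). [cite: BaysKirby2018ANT, Def. 3.8] -/
def lvGens (M : ℕ) {N : ℕ} (c : Fin N → F) : Fin N ⊕ Fin N → F :=
  Sum.elim c fun i => exp (c i / (M.factorial : F))

omit [CharZero F] in
/-- `lvGens M c (inl i) = c i`. [folklore] -/
@[simp] theorem lvGens_inl (M : ℕ) {N : ℕ} (c : Fin N → F) (i : Fin N) :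
    lvGens M c (Sum.inl i) = c i := rfl

omit [CharZero F] in
/-- `lvGens M c (inr i) = exp (c i / M!)`. [folklore] -/
@[simp] theorem lvGens_inr (M : ℕ) {N : ℕ} (c : Fin N → F) (i : Fin N) :
    lvGens M c (Sum.inr i) = exp (c i / (M.factorial : F)) := rfl

omit [CharZero F] in
/-- At level `0` the second block of generators is `exp cᵢ`. [folklore] -/
@[simp] theorem lvGens_zero_inr {N : ℕ} (c : Fin N → F) (i : Fin N) :
    lvGens 0 c (Sum.inr i) = exp (c i) := by
  simp [lvGens]

/-- The **level-`M` algebra** `K₀[c, exp (c/M!)]` of the Γ-field generated by `c` over `K`,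
`K₀ = ℚ(K, exp K)` (`fieldOf K`): a `K₀`-subalgebra of `F` whose fraction field is the level-`M`
subfield `K₀(c, exp (c/M!))` of `⟨K c⟩ = ⋃_M K₀(c, exp (c/M!))`.
[cite: BaysKirby2018ANT, Def. 3.8] -/
abbrev lvAlgebra (K : Submodule ℚ F) (M : ℕ) {N : ℕ} (c : Fin N → F) :
    Subalgebra (fieldOf K) F :=
  Algebra.adjoin (fieldOf K) (range (lvGens M c))

/-- The generators lie in the level algebra. [folklore] -/
theorem lvGens_mem_lvAlgebra (K : Submodule ℚ F) (M : ℕ) {N : ℕ} (c : Fin N → F)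
    (j : Fin N ⊕ Fin N) : lvGens M c j ∈ lvAlgebra K M c :=
  Algebra.subset_adjoin (mem_range_self j)

omit [Literature.ModelTheory.ExponentialFields.ExponentialRing F] in
/-- `x / n = (n⁻¹ : ℚ) • x` in a `ℚ`-vector space of characteristic zero. [folklore] -/
theorem div_natCast_eq_smul (x : F) (n : ℕ) : x / (n : F) = ((n : ℚ)⁻¹) • x := by
  rw [Rat.smul_def, Rat.cast_inv, Rat.cast_natCast, div_eq_inv_mul]

omit [Literature.ModelTheory.ExponentialFields.ExponentialRing F] in
/-- `cᵢ / M! ∈ K + ℚc`. [folklore] -/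
theorem div_factorial_mem_sup_span (K : Submodule ℚ F) {N : ℕ} (c : Fin N → F) (M : ℕ) (i : Fin N) :
    c i / (M.factorial : F) ∈ K ⊔ Submodule.span ℚ (range c) := by
  rw [div_natCast_eq_smul]
  exact Submodule.smul_mem _ _ (Submodule.mem_sup_right (Submodule.subset_span (mem_range_self i)))

/-- The level-`M` generators lie in `gens (K + ℚc)`. [folklore] -/
theorem lvGens_mem_gens (K : Submodule ℚ F) (M : ℕ) {N : ℕ} (c : Fin N → F) (j : Fin N ⊕ Fin N) :
    lvGens M c j ∈ gens (K ⊔ Submodule.span ℚ (range c)) := by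
  cases j with
  | inl i =>
    exact mem_gens_of_mem (Submodule.mem_sup_right (Submodule.subset_span (mem_range_self i)))
  | inr i => exact exp_mem_gens (div_factorial_mem_sup_span K c M i)


/-! ### Γ-isomorphisms over `K` -/

/-- **`c ↦ c'` is an isomorphism of Γ-fields `⟨K c⟩ ≅ ⟨K c'⟩` over `K`** (Bays–Kirby 2018,
§3: isomorphisms of Γ-fields = field isomorphisms `θ` with `θ(Γ(A)) = Γ(A')`; "over `K`" =
identity on the Γ-subfield `K`, i.e. `K₀`-linear). Rendered level-wise: for every `M` there is
a `K₀`-algebra isomorphism of the level-`M` algebras `K₀[c, exp (c/M!)] ≃ K₀[c', exp (c'/M!)]`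
sending `cᵢ ↦ c'ᵢ` and `exp (cᵢ/M!) ↦ exp (c'ᵢ/M!)`. These isomorphisms of domains extend
uniquely to the fraction fields, are compatible as `M` grows (they are determined by the
generators, and `exp (cᵢ/M!) = exp (cᵢ/(M+1)!)^(M+1)`), and their union is a field isomorphism
`θ : ⟨K c⟩ ≅ ⟨K c'⟩` over `K₀` with `θ (K + ℚc) = K + ℚc'` and `θ (exp x) = exp (θ x)` for
`x ∈ K + ℚc` — an isomorphism of Γ-fields over `K` with `θ c = c'`; conversely every such `θ`
restricts to such a family. Equivalent to "`(c, exp (c/M!))` and `(c', exp (c'/M!))` satisfy the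
same polynomial relations over `K₀` for every `M`" (`isGammaIso_iff_ker_eq`), and to the
existence of such a field isomorphism `θ` (`isGammaIso_iff_exists_ringEquiv`, proved below).
[cite: BaysKirby2018ANT, Def. 3.10 (extensions/embeddings of Γ-fields), Def. 5.2] -/
def IsGammaIso (K : Submodule ℚ F) {N : ℕ} (c c' : Fin N → F) : Prop :=
  ∀ M : ℕ, ∃ σ : lvAlgebra K M c ≃ₐ[fieldOf K] lvAlgebra K M c',
    ∀ j, (σ ⟨lvGens M c j, lvGens_mem_lvAlgebra K M c j⟩ : F) = lvGens M c' j

end GammaField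

/-! ### The named fact -/

open GammaField in
/-- **Bays–Kirby 2018, Prop. 11.5 + Prop. 11.2 (with Def. 5.14), applied as in the proof of
Cor. 11.7** — exponential case (`k = ℚ`, `G = 𝔾ₐ × 𝔾ₘ`, `𝒪 = ℤ`, `Γ` = graph of `exp`), inside a
fixed exponential field. Let `F` be a *full* Γ-field (algebraically closed, `exp` onto `Fˣ`,
Def. 3.8) which is Γ-closed (Def. 10.3 = exponentially-algebraically closed,
`Literature.NumberTheory.Transcendental.IsExpAlgClosed`, single-point form by the Rabinowitsch remark), and let `K ◁_cl F` be
countable and Γ-closed in `F` (Def. 4.9, `GammaField.IsGammaClosed`) with `K ≠ F` (so `K` is a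
countable full Γ-subfield: it is relatively algebraically closed in `F` and contains every
logarithm of its elements, since `δ(a/K) ≤ 0` for such `a`; this is the base `F_base = K` of
§5.2, Def. 5.18 and Thm 11.6). Then Γ-closedness gives
generic Γ-closedness over `K` (Cor. 11.7, proof), hence generic *strong* Γ-closedness over `K`
(Prop. 11.5, via the weak Zilber–Pink theorem 11.4), hence (Prop. 11.2) `F` is `ℵ₀`-saturated
for Γ-algebraic extensions which are purely Γ-transcendental over `K` (Def. 5.14 / Def. 5.2):

> whenever `K ◁ A ◁ F` with `A` finitely generated over `K` and `A ◁ B` is a finitely generated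
> Γ-algebraic extension (purely Γ-transcendental over `K`), then `B` embeds (necessarily
> strongly) into `F` over `A`.

Instance stated: `A = ⟨K c'⟩ ◁ F` (`c' : Fin N → F`); `B = ⟨K c e⟩ ⊆ F` regarded as an extension
of `A` through the Γ-isomorphism `⟨K c⟩ ≅ ⟨K c'⟩`, `c ↦ c'`, over `K` (`GammaField.IsGammaIso`),
where `⟨K c⟩ ◁ F` (so `⟨K c⟩ ◁ ⟨K c e⟩`), `δ(e/⟨K c⟩) = 0` (so the extension is Γ-algebraic,
Def. 5.11: every tuple from `Γ(B)` lies in a tuple of predimension `0` over `A`) and — a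
harmless extra hypothesis — `⟨K c e⟩ ◁ F`; `B` is purely Γ-transcendental over `K` because
`K ◁_cl F` (Def. 5.16, Remark 5.17). Conclusion: an embedding of `B` into `F` over `A`, i.e. a
tuple `e'` with `(c, e) ↦ (c', e')` a Γ-isomorphism `⟨K c e⟩ ≅ ⟨K c' e'⟩` over `K` (extending
`c ↦ c'`), with strong image `⟨K c' e'⟩ ◁ F`. Deep (weak Zilber–Pink); named fact (D-0014).
[cite: BaysKirby2018ANT, Prop. 11.2, Prop. 11.5, Def. 5.14, Cor. 11.7 (proof)] -/
def BaysKirby2018_saturation_of_isExpAlgClosed : Prop :=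
  ∀ {F : Type*} [Field F] [CharZero F] [Literature.ModelTheory.ExponentialFields.ExponentialRing F],
    IsAlgClosed F → Literature.ModelTheory.ExponentialFields.ExponentialRing.IsSurjectiveOntoUnits F → IsExpAlgClosed F →
    ∀ {K : Submodule ℚ F}, GammaField.IsGammaClosed K → K ≠ ⊤ → (K : Set F).Countable →
    ∀ {N k : ℕ} {c c' : Fin N → F} {e : Fin k → F},
      GammaField.IsStrong (K ⊔ Submodule.span ℚ (range c)) →
      GammaField.IsStrong (K ⊔ Submodule.span ℚ (range c')) →
      GammaField.IsGammaIso K c c' →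
      GammaField.predim (K ⊔ Submodule.span ℚ (range c)) (Submodule.span ℚ (range e)) = 0 →
      GammaField.IsStrong (K ⊔ Submodule.span ℚ (range (Fin.append c e))) →
      ∃ e' : Fin k → F, GammaField.IsGammaIso K (Fin.append c e) (Fin.append c' e') ∧
        GammaField.IsStrong (K ⊔ Submodule.span ℚ (range (Fin.append c' e')))

namespace GammaField

open Literature.ModelTheory.ExponentialFields.ExponentialRing

/-! ### Isomorphic generated algebras and ideals of relations (folklore) -/

section KerEq

variable {R A : Type*} [CommRing R] [CommRing A] [Algebra R A] {ι : Type*}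

/-- Values of polynomials in `v` lie in the algebra generated by `v`. [folklore] -/
theorem aeval_mem_adjoin_range (v : ι → A) (P : MvPolynomial ι R) :
    MvPolynomial.aeval v P ∈ Algebra.adjoin R (range v) := by
  rw [Algebra.adjoin_range_eq_range_aeval]; exact ⟨P, rfl⟩

/-- **Same relations give isomorphic generated algebras.** If two families `v w : ι → A` have
the same ideal of polynomial relations over `R`, then `R[v] ≃ₐ[R] R[w]` by an isomorphism
sending `P(v) ↦ P(w)` (both algebras are `R[X_ι]/𝔞`). [folklore] -/
theorem exists_algEquiv_adjoin_of_ker_eq' {v w : ι → A}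
    (h : RingHom.ker (MvPolynomial.aeval v : MvPolynomial ι R →ₐ[R] A) =
      RingHom.ker (MvPolynomial.aeval w : MvPolynomial ι R →ₐ[R] A)) :
    ∃ σ : Algebra.adjoin R (range v) ≃ₐ[R] Algebra.adjoin R (range w),
      ∀ P : MvPolynomial ι R,
        (σ ⟨MvPolynomial.aeval v P, aeval_mem_adjoin_range v P⟩ : A) = MvPolynomial.aeval w P := by
  classical
  let fv : MvPolynomial ι R →ₐ[R] Algebra.adjoin R (range v) :=
    (MvPolynomial.aeval v).codRestrict (Algebra.adjoin R (range v)) (aeval_mem_adjoin_range v)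
  let fw : MvPolynomial ι R →ₐ[R] Algebra.adjoin R (range w) :=
    (MvPolynomial.aeval w).codRestrict (Algebra.adjoin R (range w)) (aeval_mem_adjoin_range w)
  have hsv : Function.Surjective fv := by
    rintro ⟨a, ha⟩
    rw [Algebra.adjoin_range_eq_range_aeval] at ha
    obtain ⟨P, rfl⟩ := ha
    exact ⟨P, rfl⟩
  have hsw : Function.Surjective fw := by
    rintro ⟨a, ha⟩
    rw [Algebra.adjoin_range_eq_range_aeval] at ha
    obtain ⟨P, rfl⟩ := ha
    exact ⟨P, rfl⟩
  have hkv : RingHom.ker fv = RingHom.ker (MvPolynomial.aeval v : MvPolynomial ι R →ₐ[R] A) := by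
    ext P
    simp only [RingHom.mem_ker]
    exact ⟨fun h0 => congrArg Subtype.val h0, fun h0 => Subtype.ext h0⟩
  have hkw : RingHom.ker fw = RingHom.ker (MvPolynomial.aeval w : MvPolynomial ι R →ₐ[R] A) := by
    ext P
    simp only [RingHom.mem_ker]
    exact ⟨fun h0 => congrArg Subtype.val h0, fun h0 => Subtype.ext h0⟩
  have hker : RingHom.ker fv = RingHom.ker fw := by rw [hkv, hkw, h]
  let ev := Ideal.quotientKerAlgEquivOfSurjective hsv
  let ew := Ideal.quotientKerAlgEquivOfSurjective hsw
  let eq : (MvPolynomial ι R ⧸ RingHom.ker fv) ≃ₐ[R] (MvPolynomial ι R ⧸ RingHom.ker fw) :=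
    Ideal.quotientEquivAlgOfEq R hker
  refine ⟨ev.symm.trans (eq.trans ew), fun P => ?_⟩
  have h1 : ev.symm ⟨MvPolynomial.aeval v P, aeval_mem_adjoin_range v P⟩ =
      Ideal.Quotient.mk _ P :=
    Ideal.quotientKerAlgEquivOfSurjective_symm_apply hsv P
  have h2 : eq (Ideal.Quotient.mk _ P) = Ideal.Quotient.mk _ P :=
    Ideal.quotientEquivAlgOfEq_mk R hker P
  have h3 : ew (Ideal.Quotient.mk _ P) = fw P := Ideal.quotientKerAlgEquivOfSurjective_mk hsw P
  rw [AlgEquiv.trans_apply, AlgEquiv.trans_apply, h1, h2, h3]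
  rfl

/-- Same, with the isomorphism pinned down on the generators: `v i ↦ w i`. [folklore] -/
theorem exists_algEquiv_adjoin_of_ker_eq {v w : ι → A}
    (h : RingHom.ker (MvPolynomial.aeval v : MvPolynomial ι R →ₐ[R] A) =
      RingHom.ker (MvPolynomial.aeval w : MvPolynomial ι R →ₐ[R] A)) :
    ∃ σ : Algebra.adjoin R (range v) ≃ₐ[R] Algebra.adjoin R (range w),
      ∀ i, (σ ⟨v i, Algebra.subset_adjoin (mem_range_self i)⟩ : A) = w i := by
  obtain ⟨σ, hσ⟩ := exists_algEquiv_adjoin_of_ker_eq' h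
  refine ⟨σ, fun i => ?_⟩
  have := hσ (MvPolynomial.X i)
  simp only [MvPolynomial.aeval_X] at this
  rw [← this]

/-- **Isomorphic generated algebras have the same relations.** If `σ : R[v] ≃ₐ[R] R[w]` sends
`v i ↦ w i` then `σ (P(v)) = P(w)`. [folklore] -/
theorem algEquiv_aeval_eq {v w : ι → A}
    (σ : Algebra.adjoin R (range v) ≃ₐ[R] Algebra.adjoin R (range w))
    (hσ : ∀ i, (σ ⟨v i, Algebra.subset_adjoin (mem_range_self i)⟩ : A) = w i)
    (P : MvPolynomial ι R) :
    (σ ⟨MvPolynomial.aeval v P, aeval_mem_adjoin_range v P⟩ : A) = MvPolynomial.aeval w P := by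
  -- both sides are `R`-algebra maps `R[X_ι] → A` agreeing on the variables
  let cod : MvPolynomial ι R →ₐ[R] Algebra.adjoin R (range v) :=
    (MvPolynomial.aeval v).codRestrict (Algebra.adjoin R (range v)) (aeval_mem_adjoin_range v)
  let φ : MvPolynomial ι R →ₐ[R] A :=
    (Algebra.adjoin R (range w)).val.comp ((σ : _ →ₐ[R] _).comp cod)
  have hφ : φ = MvPolynomial.aeval w := by
    refine MvPolynomial.algHom_ext fun i => ?_
    rw [MvPolynomial.aeval_X, ← hσ i]
    have hc : cod (MvPolynomial.X i) = ⟨v i, Algebra.subset_adjoin (mem_range_self i)⟩ :=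
      Subtype.ext (MvPolynomial.aeval_X v i)
    show ((σ (cod (MvPolynomial.X i)) : Algebra.adjoin R (range w)) : A) = _
    rw [hc]
  have := congrArg (fun ψ : MvPolynomial ι R →ₐ[R] A => ψ P) hφ
  exact this

/-- With `σ` as above, `aeval v P = 0 ↔ aeval w P = 0`. [folklore] -/
theorem aeval_eq_zero_iff_of_algEquiv {v w : ι → A}
    (σ : Algebra.adjoin R (range v) ≃ₐ[R] Algebra.adjoin R (range w))
    (hσ : ∀ i, (σ ⟨v i, Algebra.subset_adjoin (mem_range_self i)⟩ : A) = w i)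
    (P : MvPolynomial ι R) :
    MvPolynomial.aeval v P = 0 ↔ MvPolynomial.aeval w P = 0 := by
  rw [← algEquiv_aeval_eq σ hσ P]
  constructor
  · intro h0
    have : (⟨MvPolynomial.aeval v P, aeval_mem_adjoin_range v P⟩ :
        Algebra.adjoin R (range v)) = 0 := Subtype.ext h0
    rw [this, map_zero]; rfl
  · intro h0
    have : σ ⟨MvPolynomial.aeval v P, aeval_mem_adjoin_range v P⟩ = 0 := Subtype.ext h0
    rw [map_eq_zero_iff σ σ.injective] at this
    exact congrArg Subtype.val this

/-- Kernel form: isomorphic generated algebras (generators matching) have equal ideals of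
relations. [folklore] -/
theorem ker_eq_of_algEquiv {v w : ι → A}
    (σ : Algebra.adjoin R (range v) ≃ₐ[R] Algebra.adjoin R (range w))
    (hσ : ∀ i, (σ ⟨v i, Algebra.subset_adjoin (mem_range_self i)⟩ : A) = w i) :
    RingHom.ker (MvPolynomial.aeval v : MvPolynomial ι R →ₐ[R] A) =
      RingHom.ker (MvPolynomial.aeval w : MvPolynomial ι R →ₐ[R] A) := by
  ext P
  rw [RingHom.mem_ker, RingHom.mem_ker]
  exact aeval_eq_zero_iff_of_algEquiv σ hσ P

end KerEq

/-! ### `IsGammaIso` is an equivalence relation; kernel form -/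

variable {F : Type*} [Field F] [CharZero F] [Literature.ModelTheory.ExponentialFields.ExponentialRing F]
variable {K : Submodule ℚ F} {N : ℕ} {c c' c'' : Fin N → F}

/-- Kernel form of `IsGammaIso`: for every level `M`, the generators `(c, exp (c/M!))` and
`(c', exp (c'/M!))` satisfy the same polynomial relations over `K₀ = ℚ(K, exp K)`. [folklore] -/
theorem isGammaIso_iff_ker_eq : IsGammaIso K c c' ↔ ∀ M : ℕ,
    RingHom.ker (MvPolynomial.aeval (lvGens M c) :
        MvPolynomial (Fin N ⊕ Fin N) (fieldOf K) →ₐ[fieldOf K] F) =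
      RingHom.ker (MvPolynomial.aeval (lvGens M c') :
        MvPolynomial (Fin N ⊕ Fin N) (fieldOf K) →ₐ[fieldOf K] F) := by
  refine ⟨fun h M => ?_, fun h M => exists_algEquiv_adjoin_of_ker_eq (h M)⟩
  obtain ⟨σ, hσ⟩ := h M
  exact ker_eq_of_algEquiv σ hσ

/-- `IsGammaIso` is reflexive. [folklore] -/
theorem IsGammaIso.refl (K : Submodule ℚ F) (c : Fin N → F) : IsGammaIso K c c :=
  fun _ => ⟨AlgEquiv.refl, fun _ => rfl⟩

/-- `IsGammaIso` is symmetric. [folklore] -/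
theorem IsGammaIso.symm (h : IsGammaIso K c c') : IsGammaIso K c' c := by
  rw [isGammaIso_iff_ker_eq] at h ⊢
  exact fun M => (h M).symm

/-- `IsGammaIso` is transitive. [folklore] -/
theorem IsGammaIso.trans (h : IsGammaIso K c c') (h' : IsGammaIso K c' c'') :
    IsGammaIso K c c'' := by
  rw [isGammaIso_iff_ker_eq] at h h' ⊢
  exact fun M => (h M).trans (h' M)

/-- Related tuples satisfy the same polynomial relations over `K₀` at every level. [folklore] -/
theorem IsGammaIso.aeval_eq_zero_iff (h : IsGammaIso K c c') (M : ℕ)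
    (P : MvPolynomial (Fin N ⊕ Fin N) (fieldOf K)) :
    MvPolynomial.aeval (lvGens M c) P = 0 ↔ MvPolynomial.aeval (lvGens M c') P = 0 := by
  obtain ⟨σ, hσ⟩ := h M
  exact aeval_eq_zero_iff_of_algEquiv σ hσ P

/-- In particular related tuples agree coordinatewise on equalities: `c i = c j ↔ c' i = c' j`.
[folklore] -/
theorem IsGammaIso.apply_eq_iff (h : IsGammaIso K c c') (i j : Fin N) :
    c i = c j ↔ c' i = c' j := by
  have := h.aeval_eq_zero_iff 0 (MvPolynomial.X (Sum.inl i) - MvPolynomial.X (Sum.inl j))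
  simpa [sub_eq_zero] using this

/-! ## `IsGammaIso` is exactly "isomorphism of Γ-fields over `K` via `c ↦ c'`" -/

section Faithfulness

/-! ### Division points at different levels -/

/-- For `M ≤ M'`, `exp (x / M!) = exp (x / M'!) ^ (M'! / M!)`. [folklore] -/
theorem exp_div_factorial_eq_pow (x : F) {M M' : ℕ} (h : M ≤ M') :
    exp (x / (M.factorial : F)) =
      exp (x / (M'.factorial : F)) ^ (M'.factorial / M.factorial) := by
  set r := M'.factorial / M.factorial with hr
  have hr' : M'.factorial = M.factorial * r :=
    (Nat.mul_div_cancel' (Nat.factorial_dvd_factorial h)).symm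
  rw [← exp_nsmul, nsmul_eq_mul]
  congr 1
  have hM : (M.factorial : F) ≠ 0 := by exact_mod_cast M.factorial_ne_zero
  have hM' : (M'.factorial : F) ≠ 0 := by exact_mod_cast M'.factorial_ne_zero
  have hr0 : (r : F) ≠ 0 := by
    have : r ≠ 0 := fun h0 => by rw [h0, mul_zero] at hr'; exact M'.factorial_ne_zero hr'
    exact_mod_cast this
  rw [hr', Nat.cast_mul]
  field_simp

/-- `exp (q • x) = exp (x / M!) ^ (q.num * (M! / q.den))` whenever `q.den ∣ M!`. [folklore] -/
theorem exp_rat_smul_eq_zpow (q : ℚ) (x : F) {M : ℕ} (hM : q.den ∣ M.factorial) :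
    exp (q • x) = exp (x / (M.factorial : F)) ^ (q.num * ((M.factorial / q.den : ℕ) : ℤ)) := by
  rw [← exp_zsmul, zsmul_eq_mul]
  congr 1
  set r := M.factorial / q.den with hr
  have hr' : M.factorial = q.den * r := (Nat.mul_div_cancel' hM).symm
  have hden : (q.den : F) ≠ 0 := by exact_mod_cast q.den_ne_zero
  have hMf : (M.factorial : F) ≠ 0 := by exact_mod_cast M.factorial_ne_zero
  have hr0 : (r : F) ≠ 0 := by
    have : r ≠ 0 := fun h0 => by rw [h0, mul_zero] at hr'; exact M.factorial_ne_zero hr'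
    exact_mod_cast this
  rw [Rat.smul_def, Rat.cast_def, hr', Nat.cast_mul, Int.cast_mul, Int.cast_natCast]
  field_simp

/-! ### The level algebras form a chain -/

/-- Level-`M` generators lie in every higher level algebra. [folklore] -/
theorem lvGens_mem_lvAlgebra_of_le (K : Submodule ℚ F) {M M' : ℕ} (h : M ≤ M') (c : Fin N → F)
    (j : Fin N ⊕ Fin N) : lvGens M c j ∈ lvAlgebra K M' c := by
  cases j with
  | inl i => exact lvGens_mem_lvAlgebra K M' c (Sum.inl i)
  | inr i =>
    rw [lvGens_inr, exp_div_factorial_eq_pow (c i) h]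
    exact Subalgebra.pow_mem _ (lvGens_mem_lvAlgebra K M' c (Sum.inr i)) _

/-- The level algebras increase with the level. [folklore] -/
theorem lvAlgebra_mono (K : Submodule ℚ F) {M M' : ℕ} (h : M ≤ M') (c : Fin N → F) :
    lvAlgebra K M c ≤ lvAlgebra K M' c :=
  Algebra.adjoin_le fun _ ⟨j, hj⟩ => hj ▸ lvGens_mem_lvAlgebra_of_le K h c j

/-- The level algebras form a directed family. [folklore] -/
theorem directed_lvAlgebra (K : Submodule ℚ F) (c : Fin N → F) :
    Directed (· ≤ ·) fun M => lvAlgebra K M c :=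
  Monotone.directed_le (f := fun M => lvAlgebra K M c) fun _ _ h => lvAlgebra_mono K h c

/-- **All division points**: the generators `cᵢ, exp (cᵢ / M!)` of all levels. The Γ-field
`⟨K c⟩` is `K₀(allGens c)` (`fieldOf_sup_span_eq`). [cite: BaysKirby2018ANT, Def. 3.8] -/
def allGens (c : Fin N → F) : Set F := ⋃ M, range (lvGens M c)

/-- `K₀[allGens c] = ⋃_M K₀[c, exp (c/M!)]`. [folklore] -/
theorem adjoin_allGens_eq_iSup (K : Submodule ℚ F) (c : Fin N → F) :
    Algebra.adjoin (fieldOf K) (allGens c) = ⨆ M, lvAlgebra K M c :=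
  Algebra.adjoin_iUnion _

/-- The level-change substitution `X_inl i ↦ X_inl i`, `X_inr i ↦ X_inr i ^ (M'!/M!)`, expressing
level-`M` generators in terms of level-`M'` generators. [folklore] -/
def lvSubst (R : Type*) [CommSemiring R] (N M M' : ℕ) :
    MvPolynomial (Fin N ⊕ Fin N) R →ₐ[R] MvPolynomial (Fin N ⊕ Fin N) R :=
  MvPolynomial.bind₁ (Sum.elim (fun i => MvPolynomial.X (Sum.inl i))
    fun i => MvPolynomial.X (Sum.inr i) ^ (M'.factorial / M.factorial))

/-- `P(lvGens M c) = (lvSubst P)(lvGens M' c)` for `M ≤ M'`. [folklore] -/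
theorem aeval_lvSubst {R : Type*} [CommSemiring R] [Algebra R F] {M M' : ℕ} (h : M ≤ M')
    (c : Fin N → F) (P : MvPolynomial (Fin N ⊕ Fin N) R) :
    MvPolynomial.aeval (lvGens M' c) (lvSubst R N M M' P) = MvPolynomial.aeval (lvGens M c) P := by
  rw [lvSubst, MvPolynomial.aeval_bind₁]
  have hfun : (fun j => MvPolynomial.aeval (lvGens M' c)
      (Sum.elim (fun i => (MvPolynomial.X (Sum.inl i) : MvPolynomial (Fin N ⊕ Fin N) R))
        (fun i => MvPolynomial.X (Sum.inr i) ^ (M'.factorial / M.factorial)) j)) = lvGens M c := by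
    funext j
    cases j with
    | inl i => simp
    | inr i => simp [exp_div_factorial_eq_pow (c i) h]
  rw [hfun]

/-! ### Elements of level algebras are polynomials in the generators -/

/-- Every element of `K₀[c, exp (c/M!)]` is `P(c, exp (c/M!))` for some polynomial `P` over `K₀`.
[folklore] -/
theorem exists_aeval_eq_of_mem_lvAlgebra {M : ℕ} {c : Fin N → F} {x : F}
    (hx : x ∈ lvAlgebra K M c) :
    ∃ P : MvPolynomial (Fin N ⊕ Fin N) (fieldOf K), MvPolynomial.aeval (lvGens M c) P = x := by
  have hx' : x ∈ Algebra.adjoin (fieldOf K) (range (lvGens M c)) := hx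
  rw [Algebra.adjoin_range_eq_range_aeval] at hx'
  obtain ⟨P, rfl⟩ := hx'
  exact ⟨P, rfl⟩

/-- Every element of `K₀[allGens c]` lies in some level algebra. [folklore] -/
theorem exists_mem_lvAlgebra_of_mem_adjoin_allGens {c : Fin N → F} {x : F}
    (hx : x ∈ Algebra.adjoin (fieldOf K) (allGens c)) : ∃ M, x ∈ lvAlgebra K M c := by
  rw [adjoin_allGens_eq_iSup, ← SetLike.mem_coe,
    Subalgebra.coe_iSup_of_directed (directed_lvAlgebra K c), mem_iUnion] at hx
  exact hx

/-- Level algebras lie in `K₀[allGens c]`. [folklore] -/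
theorem lvAlgebra_le_adjoin_allGens (K : Submodule ℚ F) (M : ℕ) (c : Fin N → F) :
    lvAlgebra K M c ≤ Algebra.adjoin (fieldOf K) (allGens c) := by
  rw [adjoin_allGens_eq_iSup]
  exact le_iSup (fun M => lvAlgebra K M c) M

/-! ### From a Γ-isomorphism to an isomorphism of the generated algebras -/

section Construction


/-- Related tuples satisfy the same relations *across levels*: if `P(lvGens M c) = Q(lvGens M' c)`
then `P(lvGens M c') = Q(lvGens M' c')` (compare both at level `max M M'`). [folklore] -/
theorem IsGammaIso.aeval_eq_aeval (h : IsGammaIso K c c') {M M' : ℕ}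
    (P Q : MvPolynomial (Fin N ⊕ Fin N) (fieldOf K))
    (hPQ : MvPolynomial.aeval (lvGens M c) P = MvPolynomial.aeval (lvGens M' c) Q) :
    MvPolynomial.aeval (lvGens M c') P = MvPolynomial.aeval (lvGens M' c') Q := by
  set L := max M M'
  have hM : M ≤ L := le_max_left _ _
  have hM' : M' ≤ L := le_max_right _ _
  have h1 : MvPolynomial.aeval (lvGens L c) (lvSubst _ N M L P - lvSubst _ N M' L Q) = 0 := by
    rw [map_sub, aeval_lvSubst hM, aeval_lvSubst hM', hPQ, sub_self]
  have h2 := (h.aeval_eq_zero_iff L _).1 h1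
  rw [map_sub, aeval_lvSubst hM, aeval_lvSubst hM', sub_eq_zero] at h2
  exact h2

/-- The level-`M` homomorphism `K₀[c, exp (c/M!)] → F`, `P(c, exp (c/M!)) ↦ P(c', exp (c'/M!))`,
attached to a Γ-isomorphism `c ↦ c'`. [folklore] -/
theorem IsGammaIso.exists_lvHom (h : IsGammaIso K c c') (M : ℕ) :
    ∃ f : lvAlgebra K M c →ₐ[fieldOf K] F, ∀ P : MvPolynomial (Fin N ⊕ Fin N) (fieldOf K),
      f ⟨MvPolynomial.aeval (lvGens M c) P, aeval_mem_adjoin_range _ P⟩ =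
        MvPolynomial.aeval (lvGens M c') P := by
  obtain ⟨σ, hσ⟩ := exists_algEquiv_adjoin_of_ker_eq' ((isGammaIso_iff_ker_eq.1 h) M)
  exact ⟨(lvAlgebra K M c').val.comp σ.toAlgHom, fun P => hσ P⟩

/-- A choice of the level homomorphisms. [folklore] -/
def IsGammaIso.lvHom (h : IsGammaIso K c c') (M : ℕ) : lvAlgebra K M c →ₐ[fieldOf K] F :=
  (h.exists_lvHom M).choose

/-- The defining property of `lvHom`. [folklore] -/
theorem IsGammaIso.lvHom_aeval (h : IsGammaIso K c c') (M : ℕ)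
    (P : MvPolynomial (Fin N ⊕ Fin N) (fieldOf K)) :
    h.lvHom M ⟨MvPolynomial.aeval (lvGens M c) P, aeval_mem_adjoin_range _ P⟩ =
      MvPolynomial.aeval (lvGens M c') P :=
  (h.exists_lvHom M).choose_spec P

/-- The level homomorphisms are compatible. [folklore] -/
theorem IsGammaIso.lvHom_apply_eq (h : IsGammaIso K c c') {M M' : ℕ} {x : F}
    (hx : x ∈ lvAlgebra K M c) (hx' : x ∈ lvAlgebra K M' c) :
    h.lvHom M ⟨x, hx⟩ = h.lvHom M' ⟨x, hx'⟩ := by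
  obtain ⟨P, hP⟩ := exists_aeval_eq_of_mem_lvAlgebra hx
  obtain ⟨Q, hQ⟩ := exists_aeval_eq_of_mem_lvAlgebra hx'
  have e1 : (⟨x, hx⟩ : lvAlgebra K M c) = ⟨_, aeval_mem_adjoin_range _ P⟩ := Subtype.ext hP.symm
  have e2 : (⟨x, hx'⟩ : lvAlgebra K M' c) = ⟨_, aeval_mem_adjoin_range _ Q⟩ := Subtype.ext hQ.symm
  rw [e1, e2, h.lvHom_aeval, h.lvHom_aeval]
  exact h.aeval_eq_aeval P Q (hP.trans hQ.symm)

/-- The homomorphism `θ₀ : K₀[allGens c] → F` obtained by gluing the level homomorphisms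
(`Subalgebra.iSupLift`). [folklore] -/
def IsGammaIso.adjoinHom (h : IsGammaIso K c c') :
    Algebra.adjoin (fieldOf K) (allGens c) →ₐ[fieldOf K] F :=
  Subalgebra.iSupLift (fun M => lvAlgebra K M c) (directed_lvAlgebra K c) h.lvHom
    (fun _ _ hij => AlgHom.ext fun x => h.lvHom_apply_eq x.2 (hij x.2))
    (Algebra.adjoin (fieldOf K) (allGens c)) (le_of_eq (adjoin_allGens_eq_iSup K c))

/-- `θ₀` on a level-`M` element. [folklore] -/
theorem IsGammaIso.adjoinHom_apply_of_mem (h : IsGammaIso K c c') {M : ℕ}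
    (x : Algebra.adjoin (fieldOf K) (allGens c)) (hx : (x : F) ∈ lvAlgebra K M c) :
    h.adjoinHom x = h.lvHom M ⟨x, hx⟩ :=
  Subalgebra.iSupLift_of_mem (K := fun M => lvAlgebra K M c) x hx

/-- `θ₀ (P(c, exp (c/M!))) = P(c', exp (c'/M!))`. [folklore] -/
theorem IsGammaIso.adjoinHom_aeval (h : IsGammaIso K c c') (M : ℕ)
    (P : MvPolynomial (Fin N ⊕ Fin N) (fieldOf K)) :
    h.adjoinHom ⟨MvPolynomial.aeval (lvGens M c) P,
        lvAlgebra_le_adjoin_allGens K M c (aeval_mem_adjoin_range _ P)⟩ =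
      MvPolynomial.aeval (lvGens M c') P := by
  rw [h.adjoinHom_apply_of_mem _ (aeval_mem_adjoin_range _ P)]
  exact h.lvHom_aeval M P

/-- `θ₀` maps generators to generators: `θ₀ (lvGens M c j) = lvGens M c' j`. [folklore] -/
theorem IsGammaIso.adjoinHom_lvGens (h : IsGammaIso K c c') (M : ℕ) (j : Fin N ⊕ Fin N) :
    h.adjoinHom ⟨lvGens M c j, lvAlgebra_le_adjoin_allGens K M c (lvGens_mem_lvAlgebra K M c j)⟩ =
      lvGens M c' j := by
  have := h.adjoinHom_aeval M (MvPolynomial.X j)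
  simp only [MvPolynomial.aeval_X] at this
  rw [← this]

/-- `θ₀` is injective. [folklore] -/
theorem IsGammaIso.adjoinHom_injective (h : IsGammaIso K c c') :
    Function.Injective h.adjoinHom := by
  rw [injective_iff_map_eq_zero]
  intro x hx
  obtain ⟨M, hM⟩ := exists_mem_lvAlgebra_of_mem_adjoin_allGens x.2
  obtain ⟨P, hP⟩ := exists_aeval_eq_of_mem_lvAlgebra hM
  have ex : x = ⟨MvPolynomial.aeval (lvGens M c) P,
      lvAlgebra_le_adjoin_allGens K M c (aeval_mem_adjoin_range _ P)⟩ := Subtype.ext hP.symm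
  rw [ex, h.adjoinHom_aeval] at hx
  rw [ex]
  exact Subtype.ext ((h.aeval_eq_zero_iff M P).2 hx)

/-- The range of `θ₀` is `K₀[allGens c']`. [folklore] -/
theorem IsGammaIso.range_adjoinHom (h : IsGammaIso K c c') :
    h.adjoinHom.range = Algebra.adjoin (fieldOf K) (allGens c') := by
  apply le_antisymm
  · rintro _ ⟨x, rfl⟩
    obtain ⟨M, hM⟩ := exists_mem_lvAlgebra_of_mem_adjoin_allGens x.2
    obtain ⟨P, hP⟩ := exists_aeval_eq_of_mem_lvAlgebra hM
    have ex : x = ⟨MvPolynomial.aeval (lvGens M c) P,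
        lvAlgebra_le_adjoin_allGens K M c (aeval_mem_adjoin_range _ P)⟩ := Subtype.ext hP.symm
    rw [ex]
    show h.adjoinHom ⟨MvPolynomial.aeval (lvGens M c) P, _⟩ ∈ _
    rw [h.adjoinHom_aeval]
    exact lvAlgebra_le_adjoin_allGens K M c' (aeval_mem_adjoin_range _ P)
  · intro y hy
    obtain ⟨M, hM⟩ := exists_mem_lvAlgebra_of_mem_adjoin_allGens hy
    obtain ⟨P, hP⟩ := exists_aeval_eq_of_mem_lvAlgebra hM
    exact ⟨⟨MvPolynomial.aeval (lvGens M c) P,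
      lvAlgebra_le_adjoin_allGens K M c (aeval_mem_adjoin_range _ P)⟩,
      (h.adjoinHom_aeval M P).trans hP⟩

/-- **The isomorphism of generated algebras** `θ₁ : K₀[allGens c] ≃ K₀[allGens c']` attached to
a Γ-isomorphism `c ↦ c'` over `K`. [folklore] -/
def IsGammaIso.adjoinEquiv (h : IsGammaIso K c c') :
    Algebra.adjoin (fieldOf K) (allGens c) ≃ₐ[fieldOf K] Algebra.adjoin (fieldOf K) (allGens c') :=
  (AlgEquiv.ofInjective h.adjoinHom h.adjoinHom_injective).trans
    (Subalgebra.equivOfEq _ _ h.range_adjoinHom)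

/-- `θ₁` is `θ₀` on underlying elements. [folklore] -/
@[simp] theorem IsGammaIso.coe_adjoinEquiv (h : IsGammaIso K c c')
    (x : Algebra.adjoin (fieldOf K) (allGens c)) : (h.adjoinEquiv x : F) = h.adjoinHom x := rfl

end Construction

/-! ### Extension to the generated fields -/

section FieldEquiv


open scoped IntermediateField.algebraAdjoinAdjoin

/-- `K₀[allGens c] ≤ K₀(allGens c)`. [folklore] -/
theorem mem_adjoinField_of_mem_adjoin {c : Fin N → F} {x : F}
    (hx : x ∈ Algebra.adjoin (fieldOf K) (allGens c)) :
    x ∈ IntermediateField.adjoin (fieldOf K) (allGens c) :=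
  IntermediateField.algebra_adjoin_le_adjoin _ _ hx

/-- **The isomorphism of generated fields** `θ : K₀(allGens c) ≃ K₀(allGens c')` attached to a
Γ-isomorphism `c ↦ c'` over `K`: the extension of `θ₁` to fraction fields
(`IsFractionRing.ringEquivOfRingEquiv`). [folklore] -/
def IsGammaIso.fieldEquiv (h : IsGammaIso K c c') :
    IntermediateField.adjoin (fieldOf K) (allGens c) ≃+*
      IntermediateField.adjoin (fieldOf K) (allGens c') :=
  IsFractionRing.ringEquivOfRingEquiv
    (A := Algebra.adjoin (fieldOf K) (allGens c))
    (B := Algebra.adjoin (fieldOf K) (allGens c'))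
    (h.adjoinEquiv :
      Algebra.adjoin (fieldOf K) (allGens c) ≃+* Algebra.adjoin (fieldOf K) (allGens c'))

/-- `θ` extends `θ₀`. [folklore] -/
theorem IsGammaIso.coe_fieldEquiv_of_mem (h : IsGammaIso K c c') {x : F}
    (hx : x ∈ Algebra.adjoin (fieldOf K) (allGens c)) :
    (h.fieldEquiv ⟨x, mem_adjoinField_of_mem_adjoin hx⟩ : F) = h.adjoinHom ⟨x, hx⟩ := by
  have := IsFractionRing.ringEquivOfRingEquiv_algebraMap
    (A := Algebra.adjoin (fieldOf K) (allGens c))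
    (K := IntermediateField.adjoin (fieldOf K) (allGens c))
    (B := Algebra.adjoin (fieldOf K) (allGens c'))
    (L := IntermediateField.adjoin (fieldOf K) (allGens c'))
    (h.adjoinEquiv :
      Algebra.adjoin (fieldOf K) (allGens c) ≃+* Algebra.adjoin (fieldOf K) (allGens c'))
    ⟨x, hx⟩
  have h1 : (algebraMap (Algebra.adjoin (fieldOf K) (allGens c))
      (IntermediateField.adjoin (fieldOf K) (allGens c)) ⟨x, hx⟩) =
      ⟨x, mem_adjoinField_of_mem_adjoin hx⟩ := rfl
  rw [h1] at this
  rw [show h.fieldEquiv = IsFractionRing.ringEquivOfRingEquiv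
    (A := Algebra.adjoin (fieldOf K) (allGens c))
    (B := Algebra.adjoin (fieldOf K) (allGens c'))
    (h.adjoinEquiv :
      Algebra.adjoin (fieldOf K) (allGens c) ≃+* Algebra.adjoin (fieldOf K) (allGens c'))
    from rfl, this]
  rfl

/-- `θ` is the identity on `K₀`. [folklore] -/
theorem IsGammaIso.coe_fieldEquiv_algebraMap (h : IsGammaIso K c c') (k : fieldOf K) :
    (h.fieldEquiv ⟨k, (IntermediateField.adjoin (fieldOf K) (allGens c)).algebraMap_mem k⟩ : F) =
      k := by
  have hk : (k : F) ∈ Algebra.adjoin (fieldOf K) (allGens c) :=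
    (Algebra.adjoin (fieldOf K) (allGens c)).algebraMap_mem k
  have := h.coe_fieldEquiv_of_mem hk
  rw [show (⟨k, mem_adjoinField_of_mem_adjoin hk⟩ :
      IntermediateField.adjoin (fieldOf K) (allGens c)) =
    ⟨k, (IntermediateField.adjoin (fieldOf K) (allGens c)).algebraMap_mem k⟩ from rfl] at this
  rw [this]
  have h2 : (⟨k, hk⟩ : Algebra.adjoin (fieldOf K) (allGens c)) =
      algebraMap (fieldOf K) (Algebra.adjoin (fieldOf K) (allGens c)) k := rfl
  rw [h2, AlgHom.commutes]
  rfl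

/-- `θ (lvGens M c j) = lvGens M c' j`; in particular `θ cᵢ = c'ᵢ` and
`θ (exp (cᵢ/M!)) = exp (c'ᵢ/M!)`. [folklore] -/
theorem IsGammaIso.coe_fieldEquiv_lvGens (h : IsGammaIso K c c') (M : ℕ) (j : Fin N ⊕ Fin N) :
    (h.fieldEquiv ⟨lvGens M c j, mem_adjoinField_of_mem_adjoin
      (lvAlgebra_le_adjoin_allGens K M c (lvGens_mem_lvAlgebra K M c j))⟩ : F) = lvGens M c' j := by
  rw [h.coe_fieldEquiv_of_mem]
  exact h.adjoinHom_lvGens M j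

end FieldEquiv

/-! ### `θ` is an isomorphism of Γ-fields over `K` -/

section GammaProperty


/-- Rational multiples of the `cᵢ` lie in `K₀[allGens c]`. [folklore] -/
theorem ratCast_mul_mem_adjoin_allGens (K : Submodule ℚ F) (c : Fin N → F) (q : ℚ) (i : Fin N) :
    (q : F) * c i ∈ Algebra.adjoin (fieldOf K) (allGens c) := by
  refine Subalgebra.mul_mem _ ?_ ?_
  · have : ((q : fieldOf K) : F) = (q : F) := rfl
    rw [← this]
    exact (Algebra.adjoin (fieldOf K) (allGens c)).algebraMap_mem (q : fieldOf K)
  · exact lvAlgebra_le_adjoin_allGens K 0 c (lvGens_mem_lvAlgebra K 0 c (Sum.inl i))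

/-- Elements of `K` lie in `K₀[allGens c]`. [folklore] -/
theorem mem_adjoin_allGens_of_mem_base {K : Submodule ℚ F} (c : Fin N → F) {k : F} (hk : k ∈ K) :
    k ∈ Algebra.adjoin (fieldOf K) (allGens c) := by
  exact (Algebra.adjoin (fieldOf K) (allGens c)).algebraMap_mem
    (⟨k, mem_fieldOf_of_mem hk⟩ : fieldOf K)

/-- `exp` of elements of `K` lie in `K₀[allGens c]`. [folklore] -/
theorem exp_mem_adjoin_allGens_of_mem_base {K : Submodule ℚ F} (c : Fin N → F) {k : F}
    (hk : k ∈ K) : exp k ∈ Algebra.adjoin (fieldOf K) (allGens c) := by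
  exact (Algebra.adjoin (fieldOf K) (allGens c)).algebraMap_mem
    (⟨exp k, exp_mem_fieldOf hk⟩ : fieldOf K)

/-- `K + ℚc ⊆ K₀[allGens c]`. [folklore] -/
theorem mem_adjoin_allGens_of_mem {K : Submodule ℚ F} {c : Fin N → F} {x : F}
    (hx : x ∈ K ⊔ Submodule.span ℚ (range c)) : x ∈ Algebra.adjoin (fieldOf K) (allGens c) := by
  obtain ⟨k, hk, y, hy, rfl⟩ := Submodule.mem_sup.1 hx
  refine Subalgebra.add_mem _ (mem_adjoin_allGens_of_mem_base c hk) ?_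
  obtain ⟨f, rfl⟩ := (Submodule.mem_span_range_iff_exists_fun ℚ).1 hy
  refine Subalgebra.sum_mem _ fun i _ => ?_
  rw [Rat.smul_def]
  exact ratCast_mul_mem_adjoin_allGens K c (f i) i

/-- `exp (q • cᵢ) ∈ K₀(allGens c)` (a power, possibly negative, of a division point). [folklore] -/
theorem exp_ratCast_mul_mem_adjoinField (K : Submodule ℚ F) (c : Fin N → F) (q : ℚ) (i : Fin N) :
    exp ((q : F) * c i) ∈ IntermediateField.adjoin (fieldOf K) (allGens c) := by
  obtain ⟨M, hM⟩ : ∃ M : ℕ, q.den ∣ M.factorial := ⟨q.den, Nat.dvd_factorial q.den_pos le_rfl⟩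
  rw [← Rat.smul_def, exp_rat_smul_eq_zpow q (c i) hM]
  exact zpow_mem (mem_adjoinField_of_mem_adjoin
    (lvAlgebra_le_adjoin_allGens K M c (lvGens_mem_lvAlgebra K M c (Sum.inr i)))) _

/-- `exp (K + ℚc) ⊆ K₀(allGens c)`. [folklore] -/
theorem exp_mem_adjoinField_of_mem {K : Submodule ℚ F} {c : Fin N → F} {x : F}
    (hx : x ∈ K ⊔ Submodule.span ℚ (range c)) :
    exp x ∈ IntermediateField.adjoin (fieldOf K) (allGens c) := by
  obtain ⟨k, hk, y, hy, rfl⟩ := Submodule.mem_sup.1 hx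
  rw [exp_add]
  refine mul_mem (mem_adjoinField_of_mem_adjoin (exp_mem_adjoin_allGens_of_mem_base c hk)) ?_
  obtain ⟨f, rfl⟩ := (Submodule.mem_span_range_iff_exists_fun ℚ).1 hy
  induction (Finset.univ : Finset (Fin N)) using Finset.induction_on with
  | empty => rw [Finset.sum_empty, exp_zero]; exact one_mem _
  | insert i s hi ih =>
    rw [Finset.sum_insert hi, exp_add]
    refine mul_mem ?_ ih
    rw [Rat.smul_def]
    exact exp_ratCast_mul_mem_adjoinField K c (f i) i

/-- **`θ` is an isomorphism of Γ-fields over `K`**: for `x ∈ K + ℚc`, `θ x ∈ K + ℚc'` and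
`θ (exp x) = exp (θ x)`. [cite: BaysKirby2018ANT, Def. 3.10] -/
theorem IsGammaIso.fieldEquiv_exp (h : IsGammaIso K c c') {x : F}
    (hx : x ∈ K ⊔ Submodule.span ℚ (range c)) :
    (h.fieldEquiv ⟨x, mem_adjoinField_of_mem_adjoin (mem_adjoin_allGens_of_mem hx)⟩ : F) ∈
        K ⊔ Submodule.span ℚ (range c') ∧
      (h.fieldEquiv ⟨exp x, exp_mem_adjoinField_of_mem hx⟩ : F) =
        exp (h.fieldEquiv ⟨x, mem_adjoinField_of_mem_adjoin (mem_adjoin_allGens_of_mem hx)⟩ : F) :=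
  by
  classical
  let E := IntermediateField.adjoin (fieldOf K) (allGens c)
  let E' := IntermediateField.adjoin (fieldOf K) (allGens c')
  let φ : E →+* F := (algebraMap E' F).comp (h.fieldEquiv : E →+* E')
  -- the inductive predicate
  let Good : F → Prop := fun x => ∃ (hx : x ∈ E) (hex : exp x ∈ E),
    φ ⟨x, hx⟩ ∈ K ⊔ Submodule.span ℚ (range c') ∧ φ ⟨exp x, hex⟩ = exp (φ ⟨x, hx⟩)
  have good_add : ∀ a b, Good a → Good b → Good (a + b) := by
    rintro a b ⟨ha, hea, ha1, ha2⟩ ⟨hb, heb, hb1, hb2⟩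
    have hab : exp (a + b) ∈ E := by rw [exp_add]; exact mul_mem hea heb
    refine ⟨add_mem ha hb, hab, ?_, ?_⟩
    · have : (⟨a + b, add_mem ha hb⟩ : E) = ⟨a, ha⟩ + ⟨b, hb⟩ := rfl
      rw [this, map_add]
      exact add_mem ha1 hb1
    · have e1 : (⟨exp (a + b), hab⟩ : E) = ⟨exp a, hea⟩ * ⟨exp b, heb⟩ := Subtype.ext (exp_add a b)
      have e2 : (⟨a + b, add_mem ha hb⟩ : E) = ⟨a, ha⟩ + ⟨b, hb⟩ := rfl
      rw [e1, map_mul, e2, map_add, ha2, hb2, exp_add]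
  have good_base : ∀ k ∈ K, Good k := by
    intro k hk
    have h1 : φ ⟨k, mem_adjoinField_of_mem_adjoin (mem_adjoin_allGens_of_mem_base c hk)⟩ = k :=
      h.coe_fieldEquiv_algebraMap ⟨k, mem_fieldOf_of_mem hk⟩
    have h2 : φ ⟨exp k, mem_adjoinField_of_mem_adjoin (exp_mem_adjoin_allGens_of_mem_base c hk)⟩ =
        exp k :=
      h.coe_fieldEquiv_algebraMap ⟨exp k, exp_mem_fieldOf hk⟩
    refine ⟨mem_adjoinField_of_mem_adjoin (mem_adjoin_allGens_of_mem_base c hk),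
      mem_adjoinField_of_mem_adjoin (exp_mem_adjoin_allGens_of_mem_base c hk), ?_, ?_⟩
    · rw [h1]; exact Submodule.mem_sup_left hk
    · rw [h1, h2]
  have good_gen : ∀ (q : ℚ) (i : Fin N), Good ((q : F) * c i) := by
    intro q i
    obtain ⟨M, hM⟩ : ∃ M : ℕ, q.den ∣ M.factorial := ⟨q.den, Nat.dvd_factorial q.den_pos le_rfl⟩
    have hci : c i ∈ E := mem_adjoinField_of_mem_adjoin
      (lvAlgebra_le_adjoin_allGens K 0 c (lvGens_mem_lvAlgebra K 0 c (Sum.inl i)))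
    have hgi : exp (c i / (M.factorial : F)) ∈ E := mem_adjoinField_of_mem_adjoin
      (lvAlgebra_le_adjoin_allGens K M c (lvGens_mem_lvAlgebra K M c (Sum.inr i)))
    have hθc : φ ⟨c i, hci⟩ = c' i := by
      have := h.coe_fieldEquiv_lvGens 0 (Sum.inl i)
      simp only [lvGens_inl] at this
      exact this
    have hθg : φ ⟨exp (c i / (M.factorial : F)), hgi⟩ = exp (c' i / (M.factorial : F)) := by
      have := h.coe_fieldEquiv_lvGens M (Sum.inr i)
      simp only [lvGens_inr] at this
      exact this
    have hθq : φ (q : E) = q := map_ratCast φ q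
    have hxE : (q : F) * c i ∈ E :=
      mem_adjoinField_of_mem_adjoin (ratCast_mul_mem_adjoin_allGens K c q i)
    have hexE : exp ((q : F) * c i) ∈ E := exp_ratCast_mul_mem_adjoinField K c q i
    have e1 : (⟨(q : F) * c i, hxE⟩ : E) = (q : E) * ⟨c i, hci⟩ := Subtype.ext rfl
    have e2 : (⟨exp ((q : F) * c i), hexE⟩ : E) =
        ⟨exp (c i / (M.factorial : F)), hgi⟩ ^ (q.num * ((M.factorial / q.den : ℕ) : ℤ)) := by
      apply (algebraMap E F).injective
      rw [map_zpow₀]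
      show exp ((q : F) * c i) = exp (c i / (M.factorial : F)) ^ _
      rw [← Rat.smul_def, exp_rat_smul_eq_zpow q (c i) hM]
    refine ⟨hxE, hexE, ?_, ?_⟩
    · rw [e1, map_mul, hθq, hθc, ← Rat.smul_def]
      exact Submodule.mem_sup_right
        (Submodule.smul_mem _ _ (Submodule.subset_span (mem_range_self i)))
    · rw [e1, e2, map_mul, map_zpow₀, hθq, hθc, hθg, ← exp_rat_smul_eq_zpow q (c' i) hM,
        Rat.smul_def]
  -- conclude
  have hgood : Good x := by
    obtain ⟨k, hk, y, hy, rfl⟩ := Submodule.mem_sup.1 hx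
    refine good_add _ _ (good_base k hk) ?_
    obtain ⟨f, rfl⟩ := (Submodule.mem_span_range_iff_exists_fun ℚ).1 hy
    refine Finset.sum_induction _ Good good_add (good_base 0 K.zero_mem) ?_
    intro i _
    rw [Rat.smul_def]
    exact good_gen (f i) i
  obtain ⟨_, _, h1, h2⟩ := hgood
  exact ⟨h1, h2⟩

end GammaProperty

/-! ### `K₀(allGens c)` is the Γ-field `⟨K c⟩ = ℚ(K + ℚc, exp (K + ℚc))` -/

section Identification

/-- All division points are generators of the Γ-subfield of `K + ℚc`. [folklore] -/
theorem allGens_subset_gens (K : Submodule ℚ F) (c : Fin N → F) :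
    allGens c ⊆ gens (K ⊔ Submodule.span ℚ (range c)) := by
  rintro x hx
  obtain ⟨M, hM⟩ := mem_iUnion.1 hx
  obtain ⟨j, rfl⟩ := hM
  exact lvGens_mem_gens K M c j

/-- **`K₀(allGens c) = ⟨K c⟩`**: the field generated over `K₀ = ℚ(K, exp K)` by all division
points `cᵢ, exp (cᵢ/M!)` is the Γ-subfield `ℚ(Λ, exp Λ)`, `Λ = K + ℚc`, of `GammaFields.lean`
(`GammaField.fieldOf`). [cite: BaysKirby2018ANT, Def. 3.8, Def. 3.15] -/
theorem restrictScalars_adjoinField_allGens (K : Submodule ℚ F) (c : Fin N → F) :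
    (IntermediateField.adjoin (fieldOf K) (allGens c)).restrictScalars ℚ =
      fieldOf (K ⊔ Submodule.span ℚ (range c)) := by
  set Λ := K ⊔ Submodule.span ℚ (range c) with hΛ
  apply le_antisymm
  · -- `K₀(allGens c) ⊆ ℚ(gens Λ)`, since `K₀ ⊆ ℚ(gens Λ)` and `allGens c ⊆ gens Λ`
    let T : IntermediateField (fieldOf K) F :=
      (fieldOf Λ).toSubfield.toIntermediateField fun k => fieldOf_mono (le_sup_left : K ≤ Λ) k.2
    have hle : IntermediateField.adjoin (fieldOf K) (allGens c) ≤ T :=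
      IntermediateField.adjoin_le_iff.2 fun x hx =>
        gens_subset_fieldOf Λ (allGens_subset_gens K c hx)
    intro x hx
    exact hle hx
  · -- `ℚ(gens Λ) ⊆ K₀(allGens c)`, since `gens Λ ⊆ K₀(allGens c)`
    change IntermediateField.adjoin ℚ (gens Λ) ≤ _
    refine IntermediateField.adjoin_le_iff.2 ?_
    rintro x (hx | ⟨y, hy, rfl⟩)
    · exact mem_adjoinField_of_mem_adjoin (mem_adjoin_allGens_of_mem hx)
    · exact exp_mem_adjoinField_of_mem hy

/-- Membership form of `restrictScalars_adjoinField_allGens`. [folklore] -/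
theorem mem_adjoinField_allGens_iff (K : Submodule ℚ F) (c : Fin N → F) {x : F} :
    x ∈ IntermediateField.adjoin (fieldOf K) (allGens c) ↔
      x ∈ fieldOf (K ⊔ Submodule.span ℚ (range c)) := by
  rw [← restrictScalars_adjoinField_allGens K c, IntermediateField.mem_restrictScalars]

end Identification

/-! ### Conversely: embeddings of Γ-fields over `K` give Γ-isomorphisms -/

section Converse


/-- **An embedding of Γ-fields over `K` with `c ↦ c'` is a Γ-isomorphism `c ↦ c'`.** If
`θ : ⟨K c⟩ → F` is a field embedding which is the identity on `K₀`, sends `cᵢ ↦ c'ᵢ` and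
satisfies `θ (exp x) = exp (θ x)` for `x ∈ K + ℚc` (i.e. `θ (Γ(⟨K c⟩)) ⊆ Γ(F)`), then
`IsGammaIso K c c'`. [cite: BaysKirby2018ANT, Def. 3.10] -/
theorem isGammaIso_of_ringHom (θ : IntermediateField.adjoin (fieldOf K) (allGens c) →+* F)
    (hK : ∀ k : fieldOf K,
      θ ⟨k, (IntermediateField.adjoin (fieldOf K) (allGens c)).algebraMap_mem k⟩ = k)
    (hc : ∀ i, θ ⟨c i, mem_adjoinField_of_mem_adjoin
      (lvAlgebra_le_adjoin_allGens K 0 c (lvGens_mem_lvAlgebra K 0 c (Sum.inl i)))⟩ = c' i)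
    (hexp : ∀ (x : F) (hx : x ∈ K ⊔ Submodule.span ℚ (range c)),
      θ ⟨exp x, exp_mem_adjoinField_of_mem hx⟩ =
        exp (θ ⟨x, mem_adjoinField_of_mem_adjoin (mem_adjoin_allGens_of_mem hx)⟩)) :
    IsGammaIso K c c' := by
  classical
  let E := IntermediateField.adjoin (fieldOf K) (allGens c)
  -- `θ` as a `K₀`-algebra map
  let θₐ : E →ₐ[fieldOf K] F :=
    { θ with
      commutes' := fun k => by
        have e : algebraMap (fieldOf K) E k = ⟨k, E.algebraMap_mem k⟩ := Subtype.ext rfl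
        show θ (algebraMap (fieldOf K) E k) = (k : F)
        rw [e]
        exact hK k }
  have hθₐ : ∀ e, θₐ e = θ e := fun _ => rfl
  rw [isGammaIso_iff_ker_eq]
  intro M
  -- `θ (P(c, exp (c/M!))) = P(c', exp (c'/M!))`
  have hmem : ∀ P : MvPolynomial (Fin N ⊕ Fin N) (fieldOf K),
      MvPolynomial.aeval (lvGens M c) P ∈ E := fun P =>
    mem_adjoinField_of_mem_adjoin (lvAlgebra_le_adjoin_allGens K M c (aeval_mem_adjoin_range _ P))
  let ψ : MvPolynomial (Fin N ⊕ Fin N) (fieldOf K) →ₐ[fieldOf K] F :=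
    θₐ.comp ((MvPolynomial.aeval (lvGens M c)).codRestrict E.toSubalgebra hmem)
  have hψ : ψ = MvPolynomial.aeval (lvGens M c') := by
    refine MvPolynomial.algHom_ext fun j => ?_
    have h1 : ψ (MvPolynomial.X j) = θ ⟨lvGens M c j, mem_adjoinField_of_mem_adjoin
        (lvAlgebra_le_adjoin_allGens K M c (lvGens_mem_lvAlgebra K M c j))⟩ := by
      show θₐ _ = θ _
      rw [hθₐ]
      congr 1
      exact Subtype.ext (MvPolynomial.aeval_X _ j)
    rw [h1, MvPolynomial.aeval_X]
    cases j with
    | inl i => simpa only [lvGens_inl] using hc i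
    | inr i =>
      simp only [lvGens_inr]
      have hci : c i ∈ E := mem_adjoinField_of_mem_adjoin
        (lvAlgebra_le_adjoin_allGens K 0 c (lvGens_mem_lvAlgebra K 0 c (Sum.inl i)))
      have hdiv : c i / (M.factorial : F) ∈ K ⊔ Submodule.span ℚ (range c) :=
        div_factorial_mem_sup_span K c M i
      have h2 := hexp _ hdiv
      have h3 : (⟨c i / (M.factorial : F), mem_adjoinField_of_mem_adjoin
          (mem_adjoin_allGens_of_mem hdiv)⟩ : E) = ⟨c i, hci⟩ / (M.factorial : E) :=
        Subtype.ext rfl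
      rw [h3, map_div₀, map_natCast, hc i] at h2
      exact h2
  ext P
  rw [RingHom.mem_ker, RingHom.mem_ker]
  have key : θ ⟨MvPolynomial.aeval (lvGens M c) P, hmem P⟩ =
      MvPolynomial.aeval (lvGens M c') P := by
    rw [← hψ]; rfl
  rw [← key, map_eq_zero_iff θ θ.injective]
  exact ⟨fun h0 => Subtype.ext h0, fun h0 => congrArg Subtype.val h0⟩

end Converse

/-! ### Summary: `IsGammaIso` is exactly "isomorphic Γ-fields over `K` via `c ↦ c'`" -/

section Summary


/-- **Faithfulness of `GammaField.IsGammaIso`.** `IsGammaIso K c c'` holds iff there is a field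
isomorphism `θ : ⟨K c⟩ ≅ ⟨K c'⟩` between the Γ-subfields generated by `c`, `c'` over `K`
(`= K₀(allGens c)`, `restrictScalars_adjoinField_allGens`) which is the identity on
`K₀ = ℚ(K, exp K)`, sends `cᵢ ↦ c'ᵢ`, maps `K + ℚc` into `K + ℚc'` and commutes with `exp`
there — i.e. an isomorphism of Γ-fields over `K` in the sense of Bays–Kirby (Def. 3.10:
`θ(Γ(A)) = Γ(A')`, here `Γ(⟨K c⟩)` = graph of `exp` on `K + ℚc`).
[cite: BaysKirby2018ANT, Def. 3.10, Def. 3.15] -/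
theorem isGammaIso_iff_exists_ringEquiv : IsGammaIso K c c' ↔
    ∃ θ : IntermediateField.adjoin (fieldOf K) (allGens c) ≃+*
        IntermediateField.adjoin (fieldOf K) (allGens c'),
      (∀ k : fieldOf K,
        (θ ⟨k, (IntermediateField.adjoin (fieldOf K) (allGens c)).algebraMap_mem k⟩ : F) = k) ∧
      (∀ i, (θ ⟨c i, mem_adjoinField_of_mem_adjoin
        (lvAlgebra_le_adjoin_allGens K 0 c (lvGens_mem_lvAlgebra K 0 c (Sum.inl i)))⟩ : F) = c' i) ∧
      ∀ (x : F) (hx : x ∈ K ⊔ Submodule.span ℚ (range c)),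
        (θ ⟨x, mem_adjoinField_of_mem_adjoin (mem_adjoin_allGens_of_mem hx)⟩ : F) ∈
            K ⊔ Submodule.span ℚ (range c') ∧
          (θ ⟨exp x, exp_mem_adjoinField_of_mem hx⟩ : F) =
            exp (θ ⟨x, mem_adjoinField_of_mem_adjoin (mem_adjoin_allGens_of_mem hx)⟩ : F) := by
  constructor
  · intro h
    refine ⟨h.fieldEquiv, h.coe_fieldEquiv_algebraMap, fun i => ?_, fun x hx => h.fieldEquiv_exp hx⟩
    have := h.coe_fieldEquiv_lvGens 0 (Sum.inl i)
    simp only [lvGens_inl] at this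
    exact this
  · rintro ⟨θ, hK, hc, hexp⟩
    refine isGammaIso_of_ringHom
      ((algebraMap (IntermediateField.adjoin (fieldOf K) (allGens c')) F).comp θ.toRingHom)
      hK hc fun x hx => (hexp x hx).2

end Summary

end Faithfulness

end GammaField

end Literature.NumberTheory.Transcendental
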